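import Literature.Probability.LatticeModels.BoxFamilyPoincare
import HarnessLib

/-!
# Fat rectangles as boxes ([Mar99] §4.2): the bridge between `Glauber.rect` / `Glauber.fatRectangles` and the
# box lemmas of `BoxSplitTwoBlockGap` / `BoxFamilyPoincare`, PROVED

Topic `Literature/Probability/LatticeModels`; cell `ym-ir`, seat lit-3.  Theorems only (D-0026).  [Mar99] §4.2
p0187 L14–18: `R(l₁,l₂) + x`, `𝓡_L` = translates of fat rectangles (`l₁ ∧ l₂ ≥ 0.1 (l₁ ∨ l₂)`) of size `≤ L`.
Here: `rect l₁ l₂ x` is the box `Π_i [x_i, x_i + l_i)`; a box `Π_i [a_i, b_i)` in `ℤ²` with positive, fat,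
`≤ L` sides is a member of `fatRectangles L` (`Glauber.IcoBox_mem_fatRectangles`); its cardinality; and the sides
of the halves `Top = {y_j ≥ s}`, `Bot = {y_j < t}` of a box.  Infrastructure for the typed fact
`Glauber.Martinelli1999_thm4_5` (plan: `BoxFamilyPoincare` module docstring).  SIBLING-SETTING material; the
Yang–Mills gap is not touched. [cite: Martinelli1999, §4.2 p0187 L14–18]
-/

open MeasureTheory ProbabilityTheory Finset Filter

noncomputable section

namespace Literature.Probability.LatticeModels

namespace Glauber

/-- `R(l₁,l₂) + x` is the box `Π_i [x_i, x_i + l_i)`. [cite: Martinelli1999, §4.2 p0187 L14–16] -/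
theorem rect_eq_IcoBox (l₁ l₂ : ℕ) (x : Site 2) :
    rect l₁ l₂ x = (Fintype.piFinset fun i => Finset.Ico ((x) i) ((x + (![(l₁ : ℤ), (l₂ : ℤ)] : Fin 2 → ℤ)) i)) := rfl

/-- A box `Π_{i<2} [a_i, b_i)` with sides `b_i − a_i = l_i` is the rectangle `R(l₀,l₁) + a`.
[cite: Martinelli1999, §4.2 p0187 L14–16] -/
theorem IcoBox_eq_rect (a b : Site 2) (l₁ l₂ : ℕ) (h0 : b 0 = a 0 + l₁) (h1 : b 1 = a 1 + l₂) :
    (Fintype.piFinset fun i => Finset.Ico ((a) i) ((b) i)) = rect l₁ l₂ a := by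
  rw [rect_eq_IcoBox]
  congr 1
  funext i
  congr 1
  fin_cases i
  · simpa using h0
  · simpa using h1

/-- A box in `ℤ²` with positive fat sides of length `≤ L` belongs to `𝓡_L`.
[cite: Martinelli1999, §4.2 p0187 L17–18] -/
theorem IcoBox_mem_fatRectangles {a b : Site 2} {L : ℕ} (hpos : ∀ i, a i < b i)
    (hfat : ∀ i i', b i - a i ≤ 10 * (b i' - a i')) (hle : ∀ i, b i - a i ≤ L) :
    (Fintype.piFinset fun i => Finset.Ico ((a) i) ((b) i)) ∈ fatRectangles L := by
  set l₁ := (b 0 - a 0).toNat with hl₁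
  set l₂ := (b 1 - a 1).toNat with hl₂
  have e₁ : (l₁ : ℤ) = b 0 - a 0 := Int.toNat_of_nonneg (by linarith [hpos 0])
  have e₂ : (l₂ : ℤ) = b 1 - a 1 := Int.toNat_of_nonneg (by linarith [hpos 1])
  refine ⟨l₁, l₂, a, ?_, ?_, ?_, ?_, IcoBox_eq_rect a b l₁ l₂ (by linarith) (by linarith)⟩
  · have := hpos 0; omega
  · have := hpos 1; omega
  · have h01 := hfat 0 1
    have h10 := hfat 1 0
    rw [← e₁, ← e₂] at h01 h10
    have : (max l₁ l₂ : ℤ) ≤ 10 * (min l₁ l₂ : ℕ) := by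
      push_cast
      rcases le_total l₁ l₂ with h | h
      · rw [max_eq_right (by exact_mod_cast h), min_eq_left (by exact_mod_cast h)]; exact h10
      · rw [max_eq_left (by exact_mod_cast h), min_eq_right (by exact_mod_cast h)]; exact h01
    exact_mod_cast this
  · have h0 := hle 0
    have h1 := hle 1
    rw [← e₁] at h0
    rw [← e₂] at h1
    have : ((max l₁ l₂ : ℕ) : ℤ) ≤ L := by push_cast; exact max_le h0 h1
    exact_mod_cast this

/-- Members of `𝓡_L` are boxes with positive fat sides `≤ L`. [cite: Martinelli1999, §4.2 p0187 L17–18] -/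
theorem exists_IcoBox_of_mem_fatRectangles {R : Finset (Site 2)} {L : ℕ} (hR : R ∈ fatRectangles L) :
    ∃ a b : Site 2, R = (Fintype.piFinset fun i => Finset.Ico ((a) i) ((b) i)) ∧ (∀ i, a i < b i) ∧ (∀ i i', b i - a i ≤ 10 * (b i' - a i')) ∧
      ∀ i, b i - a i ≤ L := by
  obtain ⟨l₁, l₂, x, h₁, h₂, hfat, hL, rfl⟩ := hR
  refine ⟨x, x + (![(l₁ : ℤ), (l₂ : ℤ)] : Fin 2 → ℤ), rect_eq_IcoBox l₁ l₂ x, ?_, ?_, ?_⟩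
  · intro i
    fin_cases i <;> simp <;> omega
  · have hmax : ((max l₁ l₂ : ℕ) : ℤ) ≤ 10 * (min l₁ l₂ : ℕ) := by exact_mod_cast hfat
    push_cast at hmax
    intro i i'
    fin_cases i <;> fin_cases i' <;> simp <;> omega
  · have hL' : ((max l₁ l₂ : ℕ) : ℤ) ≤ L := by exact_mod_cast hL
    push_cast at hL'
    intro i
    fin_cases i <;> simp <;> omega

/-- The cardinality of a box. [cite: Martinelli1999, §4.2 p0187 L14–16] -/
theorem card_IcoBox {d : ℕ} (a b : Site d) : ((Fintype.piFinset fun i => Finset.Ico ((a) i) ((b) i))).card = ∏ i, (b i - a i).toNat := by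
  rw [Fintype.card_piFinset]
  simp [Int.card_Ico]

end Glauber

end Literature.Probability.LatticeModels

end
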